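import Summits.ResolutionOfSingularities.ResolutionOfSingularities.Theorems.WeightedInvariantP3aTieFreeDrop
import HarnessLib

/-!
# The P3a cylinder move WITHOUT the tie-freeness hypothesis: the TIE LOCUS of the order-`ν` successors over the special point
# (door `HypersurfaceCentreConstruction`, stmt-ResolutionOfSingularities-19897; residual (D-b³-curve-FRAC-TIE) of `stub_keyRungGrHomLE_three`)

Topic: `Summits/ResolutionOfSingularities/ResolutionOfSingularities/Theorems`. Helper for the door item
`HypersurfaceCentreConstruction` (statement `stmt-ResolutionOfSingularities-19897`, route `WeightedInvariant`), line `local-engine`,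
def-free.  Sequel of `…P3aTieFreeDrop` (ORDER (o36), type (b): at a TIE-FREE position the order drops at every successor over the
special point) for the TIED positions met by the residual (D-b³-curve-FRAC-TIE) of the gap list of record
`keyRungGrHomLE_three_of_tieDescent_point_curveFracTie` (…KeyRungThreeOfDropCurveFracTie; crux memo CURVE-TIE.md §3–§4, sub-size (i)).

* **`LocalGameEFTCylinder.notMem_pow_transform_or_tieLocus`** — `S` regular local with regular system of parameters `(y, x, z)`
  (`spanFinrank 𝔪 = 3`), `(y, x)` prime, coprime weights `0 < q ≤ r`, `ν ≥ 1`, `f ∈ 𝒥_{rν}((y, x); (r, q)) ∖ 𝔪^{ν+1}` — NO tie-freeness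
  assumed.  At every prime `𝔫 ∋ t⁻¹, z` of `B = S[t⁻¹, 𝒥ₙ tⁿ]` off the vertex and every saturated factorisation `f = (t⁻¹)ᵃ g`,
  `t⁻¹ ∤ g`: EITHER `g/1 ∉ 𝔪_{B_𝔫}^ν` (the order drops), OR `𝔫` lies on a TIE CURVE whose tie ideal contains `f`:
  `Y - λ X^r ∈ 𝔫 ∌ X` with `f ∈ 𝒥_{(r+1)ν}((x, y - λx^r, z); (q, r+1, 1))` (and `λ = 0` or `q = 1`), OR (`q = r = 1`) `X ∈ 𝔫 ∌ Y` with
  `f ∈ 𝒥_{2ν}((y, x, z); (1, 2, 1))` (`Y = y t^r`, `X = x t^q`).  The proof is that of `notMem_pow_transform_of_tieFree` verbatim (special-fibre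
  face `Φ ≠ 0`, lex-face polynomial, res-type-098's non-degenerate face bound, K4 binary-form bound) with the three degenerate branches
  split on the tie membership instead of consuming tie-freeness (`notMem_pow_of_Y_mem` / `notMem_pow_of_steep_mem` / `notMem_pow_of_X_mem`).
* **`LocalGameEFTCylinder.adicOrder_transform_lt_or_tieLocus`** — the same in the `adicOrder` currency.
* **`LocalGameEFTCylinder.notMem_pow_transform_of_notMem_tieLocus`** — consequently the order drops at every successor over the special
  point that avoids the tie curves of the tie ideals containing `f` (a 𝔫-LOCAL tie-freeness suffices).

So at a tied curve centre the successors over the closed point where the order letter `ν` of `ι₃ᵗ` persists are confined to the `X ∉ 𝔫` chart on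
the curve `Y = λX^r` of a tie ideal containing `f` (plus the mirror position when `q = r = 1`): the `x`-chart localisation (i)(a)–(b) of
CURVE-TIE.md §3, for every `λ` at once and without the AQS-adaptation of `y`.
[OURS · L1 W4.3 · (D-b³-curve-FRAC-TIE) sub-size (i)]  Replaces the role of NO printed item; NOT a statement of the manuscript under review
[claim: Hironaka2017, status: under-review]; candidates stay candidates; AI work, weaker than expert review.  No definition; no axiom.

## References

* D. Abramovich, M. H. Quek, B. Schober, arXiv:2507.01232 (v3, 2026), Thm 1.3 (3), Cor. 3.6, §5. [AbramovichQuekSchober2025]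
* J. Włodarczyk, *Functorial resolution by torus actions*, arXiv:2203.03090, §2.3.9, §3.3. [Wlodarczyk2022]
-/

noncomputable section

open IsLocalRing Literature.AlgebraicGeometry.Resolution Polynomial
open Summit.ResolutionOfSingularities.ResolutionOfSingularities.Cruxes.HypersurfaceCentreConstruction.LocalEngine

set_option linter.dupNamespace false -- mandated namespace of this single-conjunct summit

namespace Summit.ResolutionOfSingularities.ResolutionOfSingularities.Theorems

namespace LocalGameEFTCylinder

variable {S : Type} [CommRing S] [IsRegularLocalRing S] {y x z : S} {r q : ℕ}

/-- **The tie locus of the P3a cylinder move (no tie-freeness assumed).**  See the module docstring: at a prime `𝔫 ∋ t⁻¹, z` of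
`B = S[t⁻¹, 𝒥ₙ((y,x);(r,q)) tⁿ]` off the vertex, a saturated transform `g` of `f ∈ 𝒥_{rν} ∖ 𝔪^{ν+1}` has `g/1 ∉ 𝔪_{B_𝔫}^ν`, unless `𝔫`
lies on a tie curve `Y = λX^r` (`X ∉ 𝔫`; `λ = 0` or `q = 1`) with `f` in the tie ideal `𝒥_{(r+1)ν}((x, y - λx^r, z); (q, r+1, 1))`, or
(`q = r = 1`) on `X = 0` (`Y ∉ 𝔫`) with `f ∈ 𝒥_{2ν}((y, x, z); (1, 2, 1))`.
[OURS · L1 W4.3 · (D-b³-curve-FRAC-TIE) (i)] [cite: AbramovichQuekSchober2025, Thm 1.3 (3), §5] -/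
theorem notMem_pow_transform_or_tieLocus (hyxz : Ideal.span (Set.range ![y, x, z]) = maximalIdeal S)
    (hd : (maximalIdeal S).spanFinrank = 3) [hP : (Ideal.span (Set.range ![y, x])).IsPrime]
    (hq : 0 < q) (hqr : q ≤ r) (hcop : Nat.Coprime r q) {ν : ℕ} (hν : 1 ≤ ν) {f : S}
    (hfν : f ∉ maximalIdeal S ^ (ν + 1)) (hadm : f ∈ weightedMonomialIdeal ![y, x] ![r, q] (r * ν))
    (𝔫 : Ideal (extReesAlgebra (weightedMonomialIdeal ![y, x] ![r, q]))) [𝔫.IsPrime]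
    (hT : extReesAlgebra.tInv (weightedMonomialIdeal ![y, x] ![r, q]) ∈ 𝔫)
    (hz : algebraMap S (extReesAlgebra (weightedMonomialIdeal ![y, x] ![r, q])) z ∈ 𝔫)
    (hV : ¬ extReesAlgebra.vertexIdeal (weightedMonomialIdeal ![y, x] ![r, q]) ≤ 𝔫)
    {a : ℕ} {g : extReesAlgebra (weightedMonomialIdeal ![y, x] ![r, q])}
    (hfg : algebraMap S _ f = extReesAlgebra.tInv (weightedMonomialIdeal ![y, x] ![r, q]) ^ a * g)
    (hndvd : ¬ extReesAlgebra.tInv (weightedMonomialIdeal ![y, x] ![r, q]) ∣ g) :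
    algebraMap _ (Localization.AtPrime 𝔫) g ∉ maximalIdeal (Localization.AtPrime 𝔫) ^ ν ∨
    (∃ lam : S, (lam = 0 ∨ q = 1) ∧
      f ∈ weightedMonomialIdeal ![x, y - lam * x ^ r, z] ![q, r + 1, 1] ((r + 1) * ν) ∧
      LocalGameEFTPointMove.uT ![y, x] ![r, q] 0 -
          algebraMap S _ lam * LocalGameEFTPointMove.uT ![y, x] ![r, q] 1 ^ r ∈ 𝔫 ∧
      LocalGameEFTPointMove.uT ![y, x] ![r, q] 1 ∉ 𝔫) ∨
    (q = 1 ∧ r = 1 ∧ f ∈ weightedMonomialIdeal ![y, x, z] ![1, 2, 1] (2 * ν) ∧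
      LocalGameEFTPointMove.uT ![y, x] ![r, q] 1 ∈ 𝔫 ∧ LocalGameEFTPointMove.uT ![y, x] ![r, q] 0 ∉ 𝔫) := by
  classical
  haveI := isDomain_of_isRegularLocalRing S
  have hr : 0 < r := lt_of_lt_of_le hq hqr
  have hw : ∀ i, 0 < (![r, q] : Fin 2 → ℕ) i := by
    intro i; fin_cases i
    · exact hr
    · exact hq
  have hzP : z ∉ Ideal.span (Set.range ![y, x]) := notMem_span_pair hyxz hd
  -- the two charts
  obtain ⟨ρ, -, hρker, -, hρC, -⟩ := LocalGameEFTPointMove.exists_rhoPartial ![y, x] ![r, q] hw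
    (mem_maximalIdeal_pair hyxz) (linearIndependent_toCotangent_pair hyxz hd)
  obtain ⟨ρ₀, hρ₀s, hρ₀ker, hX, hC, hT0⟩ := exists_rhoZero hyxz hd ![r, q] hw
  -- the transform and its face
  obtain ⟨l, hl, hfl⟩ := exists_finsupp_of_mem_weightedMonomialIdeal ![y, x] ![r, q] hadm
  obtain ⟨G, hG, hρG⟩ := exists_transform_of_finsupp ![y, x] ![r, q] (residue S) ρ₀ hX hC hT0 l hl hfl
  have hres : ∀ a : S, residue S a = 0 → a ∈ maximalIdeal S := fun a ha => (residue_eq_zero_iff _).mp ha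
  have hΦne := face_ne_zero hyxz hr hqr hres l hl hfl hfν
  have hndG : ¬ extReesAlgebra.tInv (weightedMonomialIdeal ![y, x] ![r, q]) ∣ G :=
    not_dvd_of_map_ne_zero _ _ ρ₀ hT0 (by rw [hρG]; exact hΦne)
  obtain ⟨-, hgG⟩ := transform_unique₀ ![y, x] ![r, q] hG hndG hfg hndvd
  rw [hgG]
  -- the prime `𝔫̄₀` of `κ[X₀, X₁]`
  have hker𝔫 := ker_le_of_eq_span_pair ρ₀ hρ₀ker 𝔫 hT hz
  haveI := map_isPrime_of_ker_le ρ₀ hρ₀s 𝔫 hker𝔫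
  have h𝔫 : 𝔫 = (𝔫.map ρ₀).comap ρ₀ := (comap_map_eq_of_ker_le ρ₀ hρ₀s 𝔫 hker𝔫).symm
  have hvert := not_span_pair_X_le_map hρ₀s hX 𝔫 hker𝔫 hV
  have hmem_iff : ∀ b, b ∈ 𝔫 ↔ ρ₀ b ∈ 𝔫.map ρ₀ := fun b => by
    constructor
    · exact Ideal.mem_map_of_mem ρ₀
    · intro hb; rw [h𝔫]; exact Ideal.mem_comap.mpr hb
  by_cases hΦ𝔫 : ρ₀ G ∈ 𝔫.map ρ₀
  swap
  · exact Or.inl (not_mem_pow_of_map_notMem ρ₀ 𝔫 _ h𝔫 hΦ𝔫 hν)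
  -- the lex-face polynomial
  have hfilt : l.support.filter (fun α => ∑ i, ![r, q] i * α i = r * ν) =
      l.support.filter (fun α => r * α 0 + q * α 1 = r * ν) := by
    ext α
    simp only [Finset.mem_filter, Fin.sum_univ_two, Matrix.cons_val_zero, Matrix.cons_val_one]
  obtain ⟨P, hdegP, hPcoeff, hΦP⟩ := exists_lexFacePolynomial hr hq hcop ν l.support (fun α => residue S (l α))
  have hΦeq : ρ₀ G = ∑ j ∈ Finset.range (P.natDegree + 1),
      MvPolynomial.C (P.coeff j) * MvPolynomial.X 0 ^ (ν - q * j) * MvPolynomial.X 1 ^ (r * j) := by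
    rw [hρG, hfilt, hΦP]
  have hdegq : q * P.natDegree ≤ ν := (Nat.mul_le_mul_left q hdegP).trans (Nat.mul_div_le ν q)
  -- membership transfer tools
  have hXmem : ∀ i, MvPolynomial.X i ∈ 𝔫.map ρ₀ → LocalGameEFTPointMove.uT ![y, x] ![r, q] i ∈ 𝔫 := fun i hi =>
    (hmem_iff _).mpr (by rw [hX]; exact hi)
  have hXnot : ∀ i, MvPolynomial.X i ∉ 𝔫.map ρ₀ → LocalGameEFTPointMove.uT ![y, x] ![r, q] i ∉ 𝔫 := fun i hi h =>
    hi (by rw [← hX]; exact (hmem_iff _).mp h)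
  rcases lt_or_eq_of_le hqr with hlt | heq
  · -- CASE `q < r`: the vertex coefficient is a unit
    have hv0 : (![ν - q * 0, r * 0] : Fin 2 → ℕ) = ![ν, 0] := by simp
    have hP0 : P.coeff 0 ≠ 0 := by
      rw [hPcoeff, if_pos (Nat.succ_pos _), hv0]
      have hne := residue_vertex_ne_zero hyxz hlt hres l hl hfl hfν
      rw [if_pos (Finsupp.mem_support_iff.mpr fun h0 => hne (by rw [h0, map_zero]))]
      exact hne
    by_cases hdeg0 : P.natDegree = 0
    · -- degenerate face `c₀ X₀^ν`: the successor lies on `Y = 0`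
      have hΦ0 : ρ₀ G = MvPolynomial.C (P.coeff 0) * MvPolynomial.X 0 ^ ν := by
        rw [hΦeq, lexFace_sum_eq_of_natDegree_eq_zero 0 1 r q ν hdeg0]
      have hX0 : (MvPolynomial.X 0 : MvPolynomial (Fin 2) (ResidueField S)) ∈ 𝔫.map ρ₀ :=
        mem_of_C_mul_pow_mem hP0 (by rw [← hΦ0]; exact hΦ𝔫)
      have hX1 : (MvPolynomial.X 1 : MvPolynomial (Fin 2) (ResidueField S)) ∉ 𝔫.map ρ₀ :=
        X_notMem_of_sub_mem (μ := (0 : ResidueField S)) Fin.zero_ne_one hr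
          (by rw [map_zero, zero_mul, sub_zero]; exact hX0) hvert
      by_cases hft : f ∈ weightedMonomialIdeal ![x, y - 0 * x ^ r, z] ![q, r + 1, 1] ((r + 1) * ν)
      · refine Or.inr (Or.inl ⟨0, Or.inl rfl, hft, ?_, hXnot 1 hX1⟩)
        rw [map_zero, zero_mul, sub_zero]
        exact hXmem 0 hX0
      · have hft' : f ∉ weightedMonomialIdeal ![x, y, z] ![q, r + 1, 1] ((r + 1) * ν) := by
          rwa [zero_mul, sub_zero] at hft
        exact Or.inl (notMem_pow_of_Y_mem hyxz hzP hρker hρC hρ₀s hρ₀ker hX 𝔫 hT hz hG hq (hXmem 0 hX0) (hXnot 1 hX1)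
          hft')
    by_cases hpow : ∃ cc lb : ResidueField S, P = C cc * (X - C lb) ^ ν
    · -- degenerate face `c (X₁^r - l X₀)^ν`: `q = 1` and the successor lies on `Y = l⁻¹ X^r`
      obtain ⟨cc, lb, hcl⟩ := hpow
      have hcc0 : cc ≠ 0 := by
        intro h0; apply hP0; rw [hcl, h0, map_zero, zero_mul, Polynomial.coeff_zero]
      have hdegν : P.natDegree = ν := by
        rw [hcl, Polynomial.natDegree_C_mul hcc0, Polynomial.natDegree_pow, Polynomial.natDegree_X_sub_C, mul_one]
      have hq1 : q = 1 := by
        have h1 : q * ν ≤ ν := by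
          calc q * ν = q * P.natDegree := by rw [hdegν]
            _ ≤ ν := hdegq
        have h2 : 1 * ν ≤ q * ν := Nat.mul_le_mul_right ν hq
        by_contra hne
        have h3 : 2 * ν ≤ q * ν := Nat.mul_le_mul_right ν (by omega)
        omega
      have hlb0 : lb ≠ 0 := by
        intro h0
        apply hP0
        rw [hcl, h0, map_zero, sub_zero, Polynomial.coeff_C_mul, Polynomial.coeff_X_pow, if_neg (by omega), mul_zero]
      -- `Φ = C(cc (-lb)^ν) · (X₀ - lb⁻¹ X₁^r)^ν`
      have hΦ1 : ρ₀ G = MvPolynomial.C (cc * (-lb) ^ ν) *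
          (MvPolynomial.X 0 - MvPolynomial.C lb⁻¹ * MvPolynomial.X 1 ^ r) ^ ν := by
        rw [hΦeq, hdegν]
        have h := lexFace_sum_eq_C_mul_pow (κ := ResidueField S) 0 1 r ν hcl
        simp_rw [hq1, one_mul] at h ⊢
        rw [h, X_pow_sub_C_mul_X_eq 0 1 r hlb0, mul_pow, ← mul_assoc, ← map_pow, ← map_mul]
      have hunit : cc * (-lb) ^ ν ≠ 0 := mul_ne_zero hcc0 (pow_ne_zero _ (neg_ne_zero.mpr hlb0))
      have hLmem : MvPolynomial.X 0 - MvPolynomial.C lb⁻¹ * MvPolynomial.X 1 ^ r ∈ 𝔫.map ρ₀ :=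
        mem_of_C_mul_pow_mem hunit (by rw [← hΦ1]; exact hΦ𝔫)
      have hX1 : (MvPolynomial.X 1 : MvPolynomial (Fin 2) (ResidueField S)) ∉ 𝔫.map ρ₀ :=
        X_notMem_of_sub_mem Fin.zero_ne_one hr hLmem hvert
      obtain ⟨lam, hlam⟩ := IsLocalRing.residue_surjective (R := S) lb⁻¹
      have hWmem : LocalGameEFTPointMove.uT ![y, x] ![r, q] 0 -
          algebraMap S _ lam * LocalGameEFTPointMove.uT ![y, x] ![r, q] 1 ^ r ∈ 𝔫 := by
        refine (hmem_iff _).mpr ?_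
        rw [map_sub, map_mul, map_pow, hX, hX, hC, hlam]
        exact hLmem
      by_cases hft : f ∈ weightedMonomialIdeal ![x, y - lam * x ^ r, z] ![q, r + 1, 1] ((r + 1) * ν)
      · exact Or.inr (Or.inl ⟨lam, Or.inr hq1, hft, hWmem, hXnot 1 hX1⟩)
      · exact Or.inl (notMem_pow_of_steep_mem hyxz hzP hρker hρC hρ₀s hρ₀ker hX hC 𝔫 hT hz hG hq1 hr lam hWmem
          (hXnot 1 hX1) hft)
    · -- non-degenerate face: res-type-098's face bound, transferred along `B_𝔫 → κ[X₀,X₁]_{𝔫̄₀}`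
      exact Or.inl (not_mem_pow_of_map ρ₀ 𝔫 _ h𝔫
        (LexMaxOrderDrop.algebraMap_lexFace_notMem_pow hr hq hcop hν hdegq hP0 (Nat.pos_of_ne_zero hdeg0) hpow hΦeq
          (𝔫.map ρ₀) hvert))
  · -- CASE `q = r` (`= 1` by coprimality): a binary form of degree `ν`
    have hr1 : r = 1 := by have h := hcop; rw [← heq] at h; rw [← heq]; exact (Nat.coprime_self _).mp h
    have hq1 : q = 1 := heq.trans hr1
    subst hq1 hr1
    have hdegν : P.natDegree ≤ ν := by simpa using hdegP
    -- the binary face on `range (ν + 1)` (res-type-078's K4 shape, chart `X₀ ∉ 𝔫̄₀`)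
    have hΦν : ρ₀ G = ∑ k ∈ Finset.range (ν + 1),
        MvPolynomial.C (P.coeff k) * MvPolynomial.X 0 ^ (1 * (ν - k)) * MvPolynomial.X 1 ^ k := by
      rw [hΦeq, lexFace_sum_range_eq 0 1 1 1 hdegν]
      simp only [one_mul]
    by_cases hX0 : (MvPolynomial.X 0 : MvPolynomial (Fin 2) (ResidueField S)) ∈ 𝔫.map ρ₀
    · -- chart `X₁ ∉ 𝔫̄₀`: reflect the binary form
      have hX1 : (MvPolynomial.X 1 : MvPolynomial (Fin 2) (ResidueField S)) ∉ 𝔫.map ρ₀ := fun h1 => hvert (by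
        rw [Ideal.span_le, Set.insert_subset_iff, Set.singleton_subset_iff]; exact ⟨hX0, h1⟩)
      have hΦr : ρ₀ G = ∑ k ∈ Finset.range (ν + 1), MvPolynomial.C ((Polynomial.reflect ν P).coeff k) *
          MvPolynomial.X 1 ^ (1 * (ν - k)) * MvPolynomial.X 0 ^ k := by
        rw [hΦν]
        simp only [one_mul]
        exact binaryFace_sum_reflect P
      have hdegr : (Polynomial.reflect ν P).natDegree ≤ ν :=
        Polynomial.natDegree_reflect_le.trans (max_le le_rfl hdegν)
      by_cases hpow : ∃ cc lb : ResidueField S, Polynomial.reflect ν P = C cc * (X - C lb) ^ ν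
      · -- `Φ = c (X₀ - l X₁)^ν`: the successor lies on `Y = l X`
        obtain ⟨cc, lb, hcl⟩ := hpow
        have hΦ1 : ρ₀ G = MvPolynomial.C cc * (MvPolynomial.X 0 - MvPolynomial.C lb * MvPolynomial.X 1 ^ 1) ^ ν := by
          rw [hΦr]
          have h := lexFace_sum_eq_C_mul_pow (κ := ResidueField S) 1 0 1 ν hcl
          simp only [one_mul, pow_one] at h ⊢
          exact h
        have hcc0 : cc ≠ 0 := by
          intro h0; apply hΦne; rw [← hρG, hΦ1, h0, map_zero, zero_mul]
        have hLmem : MvPolynomial.X 0 - MvPolynomial.C lb * MvPolynomial.X 1 ^ 1 ∈ 𝔫.map ρ₀ :=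
          mem_of_C_mul_pow_mem hcc0 (by rw [← hΦ1]; exact hΦ𝔫)
        obtain ⟨lam, hlam⟩ := IsLocalRing.residue_surjective (R := S) lb
        have hWmem : LocalGameEFTPointMove.uT ![y, x] ![1, 1] 0 -
            algebraMap S _ lam * LocalGameEFTPointMove.uT ![y, x] ![1, 1] 1 ^ 1 ∈ 𝔫 := by
          refine (hmem_iff _).mpr ?_
          rw [map_sub, map_mul, map_pow, hX, hX, hC, hlam]
          exact hLmem
        by_cases hft : f ∈ weightedMonomialIdeal ![x, y - lam * x ^ 1, z] ![1, 1 + 1, 1] ((1 + 1) * ν)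
        · exact Or.inr (Or.inl ⟨lam, Or.inr rfl, hft, hWmem, hXnot 1 hX1⟩)
        · exact Or.inl (notMem_pow_of_steep_mem hyxz hzP hρker hρC hρ₀s hρ₀ker hX hC 𝔫 hT hz hG rfl one_pos lam hWmem
            (hXnot 1 hX1) hft)
      · exact Or.inl (not_mem_pow_of_map ρ₀ 𝔫 _ h𝔫
          (LocalGameEFTFace.algebraMap_face_notMem_pow_of_notMem (Fin.zero_ne_one (n := 0)).symm hν hdegr hpow hΦr
            (𝔫.map ρ₀) hX1))
    · -- chart `X₀ ∉ 𝔫̄₀`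
      by_cases hpow : ∃ cc lb : ResidueField S, P = C cc * (X - C lb) ^ ν
      · obtain ⟨cc, lb, hcl⟩ := hpow
        have hΦ1 : ρ₀ G = MvPolynomial.C cc * (MvPolynomial.X 1 ^ 1 - MvPolynomial.C lb * MvPolynomial.X 0) ^ ν := by
          rw [hΦν]
          have h := lexFace_sum_eq_C_mul_pow (κ := ResidueField S) 0 1 1 ν hcl
          simp only [one_mul] at h ⊢
          exact h
        have hcc0 : cc ≠ 0 := by
          intro h0; apply hΦne; rw [← hρG, hΦ1, h0, map_zero, zero_mul]
        by_cases hlb0 : lb = 0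
        · -- `Φ = c X₁^ν`: the successor lies on `X = 0`
          subst hlb0
          have hmem1 : MvPolynomial.C cc * (MvPolynomial.X 1 ^ 1) ^ ν ∈ 𝔫.map ρ₀ := by
            have h := hΦ𝔫
            rw [hΦ1, map_zero, zero_mul, sub_zero] at h
            exact h
          have hX1 : (MvPolynomial.X 1 : MvPolynomial (Fin 2) (ResidueField S)) ∈ 𝔫.map ρ₀ := by
            have h := mem_of_C_mul_pow_mem hcc0 hmem1
            rwa [pow_one] at h
          by_cases hft : f ∈ weightedMonomialIdeal ![y, x, z] ![1, 2, 1] (2 * ν)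
          · exact Or.inr (Or.inr ⟨rfl, rfl, hft, hXmem 1 hX1, hXnot 0 hX0⟩)
          · exact Or.inl (notMem_pow_of_X_mem hyxz hzP hρker hρC hρ₀s hρ₀ker hX 𝔫 hT hz hG rfl rfl (hXmem 1 hX1)
              (hXnot 0 hX0) hft)
        · -- `Φ = c' (X₀ - l⁻¹ X₁)^ν`: the successor lies on `Y = l⁻¹ X`
          have hΦ2 : ρ₀ G = MvPolynomial.C (cc * (-lb) ^ ν) *
              (MvPolynomial.X 0 - MvPolynomial.C lb⁻¹ * MvPolynomial.X 1 ^ 1) ^ ν := by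
            rw [hΦ1, X_pow_sub_C_mul_X_eq 0 1 1 hlb0, mul_pow, ← mul_assoc, ← map_pow, ← map_mul]
          have hunit : cc * (-lb) ^ ν ≠ 0 := mul_ne_zero hcc0 (pow_ne_zero _ (neg_ne_zero.mpr hlb0))
          have hLmem : MvPolynomial.X 0 - MvPolynomial.C lb⁻¹ * MvPolynomial.X 1 ^ 1 ∈ 𝔫.map ρ₀ :=
            mem_of_C_mul_pow_mem hunit (by rw [← hΦ2]; exact hΦ𝔫)
          have hX1 : (MvPolynomial.X 1 : MvPolynomial (Fin 2) (ResidueField S)) ∉ 𝔫.map ρ₀ :=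
            X_notMem_of_sub_mem Fin.zero_ne_one one_pos hLmem hvert
          obtain ⟨lam, hlam⟩ := IsLocalRing.residue_surjective (R := S) lb⁻¹
          have hWmem : LocalGameEFTPointMove.uT ![y, x] ![1, 1] 0 -
              algebraMap S _ lam * LocalGameEFTPointMove.uT ![y, x] ![1, 1] 1 ^ 1 ∈ 𝔫 := by
            refine (hmem_iff _).mpr ?_
            rw [map_sub, map_mul, map_pow, hX, hX, hC, hlam]
            exact hLmem
          by_cases hft : f ∈ weightedMonomialIdeal ![x, y - lam * x ^ 1, z] ![1, 1 + 1, 1] ((1 + 1) * ν)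
          · exact Or.inr (Or.inl ⟨lam, Or.inr rfl, hft, hWmem, hXnot 1 hX1⟩)
          · exact Or.inl (notMem_pow_of_steep_mem hyxz hzP hρker hρC hρ₀s hρ₀ker hX hC 𝔫 hT hz hG rfl one_pos lam hWmem
              (hXnot 1 hX1) hft)
      · exact Or.inl (not_mem_pow_of_map ρ₀ 𝔫 _ h𝔫
          (LocalGameEFTFace.algebraMap_face_notMem_pow_of_notMem (Fin.zero_ne_one (n := 0)) hν hdegν hpow hΦν
            (𝔫.map ρ₀) hX0))

/-- **`adicOrder` form of the tie locus.** [OURS · L1 W4.3 · (D-b³-curve-FRAC-TIE) (i)] [cite: AbramovichQuekSchober2025, Thm 1.3 (3)] -/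
theorem adicOrder_transform_lt_or_tieLocus (hyxz : Ideal.span (Set.range ![y, x, z]) = maximalIdeal S)
    (hd : (maximalIdeal S).spanFinrank = 3) [hP : (Ideal.span (Set.range ![y, x])).IsPrime]
    (hq : 0 < q) (hqr : q ≤ r) (hcop : Nat.Coprime r q) {ν : ℕ} (hν : 1 ≤ ν) {f : S}
    (hfν : f ∉ maximalIdeal S ^ (ν + 1)) (hadm : f ∈ weightedMonomialIdeal ![y, x] ![r, q] (r * ν))
    (𝔫 : Ideal (extReesAlgebra (weightedMonomialIdeal ![y, x] ![r, q]))) [𝔫.IsPrime]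
    (hT : extReesAlgebra.tInv (weightedMonomialIdeal ![y, x] ![r, q]) ∈ 𝔫)
    (hz : algebraMap S (extReesAlgebra (weightedMonomialIdeal ![y, x] ![r, q])) z ∈ 𝔫)
    (hV : ¬ extReesAlgebra.vertexIdeal (weightedMonomialIdeal ![y, x] ![r, q]) ≤ 𝔫)
    {a : ℕ} {g : extReesAlgebra (weightedMonomialIdeal ![y, x] ![r, q])}
    (hfg : algebraMap S _ f = extReesAlgebra.tInv (weightedMonomialIdeal ![y, x] ![r, q]) ^ a * g)
    (hndvd : ¬ extReesAlgebra.tInv (weightedMonomialIdeal ![y, x] ![r, q]) ∣ g) :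
    adicOrder (algebraMap _ (Localization.AtPrime 𝔫) g) < (ν : ℕ∞) ∨
    (∃ lam : S, (lam = 0 ∨ q = 1) ∧
      f ∈ weightedMonomialIdeal ![x, y - lam * x ^ r, z] ![q, r + 1, 1] ((r + 1) * ν) ∧
      LocalGameEFTPointMove.uT ![y, x] ![r, q] 0 -
          algebraMap S _ lam * LocalGameEFTPointMove.uT ![y, x] ![r, q] 1 ^ r ∈ 𝔫 ∧
      LocalGameEFTPointMove.uT ![y, x] ![r, q] 1 ∉ 𝔫) ∨
    (q = 1 ∧ r = 1 ∧ f ∈ weightedMonomialIdeal ![y, x, z] ![1, 2, 1] (2 * ν) ∧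
      LocalGameEFTPointMove.uT ![y, x] ![r, q] 1 ∈ 𝔫 ∧ LocalGameEFTPointMove.uT ![y, x] ![r, q] 0 ∉ 𝔫) := by
  rcases notMem_pow_transform_or_tieLocus hyxz hd hq hqr hcop hν hfν hadm 𝔫 hT hz hV hfg hndvd with h | h | h
  · exact Or.inl (adicOrder_lt_of_not_mem_pow hν h)
  · exact Or.inr (Or.inl h)
  · exact Or.inr (Or.inr h)

/-- **A 𝔫-LOCAL tie-freeness suffices for the order drop**: if `f` avoids the tie ideal of every tie curve through `𝔫` (and, when
`q = r = 1`, the ideal `𝒥_{2ν}((y, x, z); (1, 2, 1))` if `𝔫` lies on `X = 0`), then `g/1 ∉ 𝔪_{B_𝔫}^ν`.  `notMem_pow_transform_of_tieFree` is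
the special case of a position tie-free for every `λ`. [OURS · L1 W4.3 · (D-b³-curve-FRAC-TIE) (i)] [cite: AbramovichQuekSchober2025, Thm 1.3 (3)] -/
theorem notMem_pow_transform_of_notMem_tieLocus (hyxz : Ideal.span (Set.range ![y, x, z]) = maximalIdeal S)
    (hd : (maximalIdeal S).spanFinrank = 3) [hP : (Ideal.span (Set.range ![y, x])).IsPrime]
    (hq : 0 < q) (hqr : q ≤ r) (hcop : Nat.Coprime r q) {ν : ℕ} (hν : 1 ≤ ν) {f : S}
    (hfν : f ∉ maximalIdeal S ^ (ν + 1)) (hadm : f ∈ weightedMonomialIdeal ![y, x] ![r, q] (r * ν))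
    (𝔫 : Ideal (extReesAlgebra (weightedMonomialIdeal ![y, x] ![r, q]))) [𝔫.IsPrime]
    (hT : extReesAlgebra.tInv (weightedMonomialIdeal ![y, x] ![r, q]) ∈ 𝔫)
    (hz : algebraMap S (extReesAlgebra (weightedMonomialIdeal ![y, x] ![r, q])) z ∈ 𝔫)
    (hV : ¬ extReesAlgebra.vertexIdeal (weightedMonomialIdeal ![y, x] ![r, q]) ≤ 𝔫)
    {a : ℕ} {g : extReesAlgebra (weightedMonomialIdeal ![y, x] ![r, q])}
    (hfg : algebraMap S _ f = extReesAlgebra.tInv (weightedMonomialIdeal ![y, x] ![r, q]) ^ a * g)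
    (hndvd : ¬ extReesAlgebra.tInv (weightedMonomialIdeal ![y, x] ![r, q]) ∣ g)
    (htie : ∀ lam : S, (lam = 0 ∨ q = 1) →
      LocalGameEFTPointMove.uT ![y, x] ![r, q] 0 -
          algebraMap S _ lam * LocalGameEFTPointMove.uT ![y, x] ![r, q] 1 ^ r ∈ 𝔫 →
      LocalGameEFTPointMove.uT ![y, x] ![r, q] 1 ∉ 𝔫 →
      f ∉ weightedMonomialIdeal ![x, y - lam * x ^ r, z] ![q, r + 1, 1] ((r + 1) * ν))
    (htie' : q = 1 → r = 1 → LocalGameEFTPointMove.uT ![y, x] ![r, q] 1 ∈ 𝔫 →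
      LocalGameEFTPointMove.uT ![y, x] ![r, q] 0 ∉ 𝔫 → f ∉ weightedMonomialIdeal ![y, x, z] ![1, 2, 1] (2 * ν)) :
    algebraMap _ (Localization.AtPrime 𝔫) g ∉ maximalIdeal (Localization.AtPrime 𝔫) ^ ν := by
  rcases notMem_pow_transform_or_tieLocus hyxz hd hq hqr hcop hν hfν hadm 𝔫 hT hz hV hfg hndvd with
      h | ⟨lam, hlq, hft, hW, hX⟩ | ⟨hq1, hr1, hft, hX, hY⟩
  · exact h
  · exact absurd hft (htie lam hlq hW hX)
  · exact absurd hft (htie' hq1 hr1 hX hY)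

/-! ### The tie locus in intrinsic terms: `Y`, `X`, `Y - λX^r` through the local equations `y = (t⁻¹)^r Y`, `x = (t⁻¹)^q X` -/

omit [IsRegularLocalRing S] in
/-- `X = x t^q` is the unique `X'` with `x = (t⁻¹)^q X'` (`S` a domain). [folklore] -/
theorem eq_uT_one_of_algebraMap_x_eq [IsDomain S] {X' : extReesAlgebra (weightedMonomialIdeal ![y, x] ![r, q])}
    (h : algebraMap S _ x = extReesAlgebra.tInv (weightedMonomialIdeal ![y, x] ![r, q]) ^ q * X') :
    X' = LocalGameEFTPointMove.uT ![y, x] ![r, q] 1 := by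
  rw [algebraMap_x_eq] at h
  have hT0 : extReesAlgebra.tInv (weightedMonomialIdeal ![y, x] ![r, q]) ≠ 0 :=
    nonZeroDivisors.ne_zero (tInv_mem_nonZeroDivisors _)
  exact (mul_left_cancel₀ (pow_ne_zero q hT0) h).symm

omit [IsRegularLocalRing S] in
/-- `Y = y t^r` is the unique `W` with `y = (t⁻¹)^r W` (`S` a domain). [folklore] -/
theorem eq_uT_zero_of_algebraMap_y_eq [IsDomain S] {W : extReesAlgebra (weightedMonomialIdeal ![y, x] ![r, q])}
    (h : algebraMap S _ y = extReesAlgebra.tInv (weightedMonomialIdeal ![y, x] ![r, q]) ^ r * W) :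
    W = LocalGameEFTPointMove.uT ![y, x] ![r, q] 0 := by
  rw [algebraMap_y_eq] at h
  have hT0 : extReesAlgebra.tInv (weightedMonomialIdeal ![y, x] ![r, q]) ≠ 0 :=
    nonZeroDivisors.ne_zero (tInv_mem_nonZeroDivisors _)
  exact (mul_left_cancel₀ (pow_ne_zero r hT0) h).symm

omit [IsRegularLocalRing S] in
/-- On the tie locus (`λ = 0` or `q = 1`) the local equation `y - λx^r = (t⁻¹)^r (Y - λX^r)`. [cite: Wlodarczyk2022, §2.3.9] -/
theorem algebraMap_y_sub_eq {lam : S} (hlq : lam = 0 ∨ q = 1) :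
    algebraMap S (extReesAlgebra (weightedMonomialIdeal ![y, x] ![r, q])) (y - lam * x ^ r) =
      extReesAlgebra.tInv (weightedMonomialIdeal ![y, x] ![r, q]) ^ r *
        (LocalGameEFTPointMove.uT ![y, x] ![r, q] 0 -
          algebraMap S _ lam * LocalGameEFTPointMove.uT ![y, x] ![r, q] 1 ^ r) := by
  rcases hlq with rfl | rfl
  · rw [zero_mul, sub_zero, map_zero, zero_mul, sub_zero, algebraMap_y_eq]
  · rw [map_sub, map_mul, map_pow, algebraMap_y_eq, algebraMap_x_eq, pow_one]
    ring

end LocalGameEFTCylinder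

end Summit.ResolutionOfSingularities.ResolutionOfSingularities.Theorems

end
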